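import Literature.AnabelianGeometry.EtaleTheta.Discharge.Sec4NonVacuityTowerPicture
import HarnessLib

/-!
# [EtTh] §4 over the GENUINE Kummer tower: a self-equivalence with NON-TRIVIAL base part — complex-conjugation
# type twist `Ψ` (invert constants) over `Ψ^bs` = negation of the deck transformations (consistency witness, part 13 — data)

S. Mochizuki, *The étale theta function and its Frobenioid-theoretic manifestations*, Publ. RIMS **45**
(2009) [MochizukiEtTh2009], §4, Thm 4.4 pp.93–95 (PDF): "`Ψ : C₁ ⥲ C₂` … induces an equivalence
`Ψ^bs : D₁ ⥲ D₂`" (T44-L09), the isomorphisms `Aut_{D₁}(A^bs) ≅ Aut_{D₂}(Ψ(A)^bs)` and their compatibility with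
`H_⊙` (T44-L09c); [FrdI] Thm 5.2 (i) (morphisms of the model Frobenioid).

CONSISTENCY WITNESS, TOY — sequel of parts 10–12 (`Sec4NonVacuityTower*.lean`, p438749 p439046 p439630 p440797:
the `ToyTower` setting over the genuine Kummer tower, `Aut(X_N) = ℤ/N`).  Every `Thm44Hyp` inhabitant of the cell
so far has `Ψ^bs = 𝟭` (`ToyCov.thm44HypTwist` p431777; the identity hypotheses of `Toy`/`ToyCov`/`ToyTower`) — over
the collapsed base nothing else exists (`Aut = 1`).  Over the genuine tower there is a self-equivalence with
NON-TRIVIAL base part, the algebraic shadow of complex conjugation `t ↦ t̄` on `𝔾_m`: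
* `negBase : D ⥤ D` — identity on objects, NEGATES every shift (`t_N = ζ_N^a t_M^{M/N} ↦ ζ_N^{-a} …`; conjugation
  inverts roots of unity); an involution, `negBaseEquiv : D ≌ D`; it MOVES the deck transformation `1 ∈ ℤ/3` of `X_3`;
* `conjFn` — on `B(X_N) = ℂˣ × t^ℤ`: invert the constant (`c·t^n ↦ c⁻¹·t^n`; divisor unchanged); it intertwines
  the pull-backs along `f` and `negBase f` (`conjFn_map`: `(c ζ^{an})⁻¹ = c⁻¹ ζ^{-an}`);
* `conj : C ⥤ C` — `(d, b, Div, u) ↦ (d, negBase b, Div, conjFn u)` on the morphisms of the model Frobenioid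
  ([FrdI] Thm 5.2 (i); the relation only sees `Div_B(u)` and the degree of `b`), an involution, `conjEquiv : C ≌ C`;
* `thm44HypConj p` — the inhabitant of abc-iut-L2-t3's `Thm44Hyp` with `Ψ := conjEquiv`, **`Ψ^bs := negBaseEquiv`**,
  `Base ∘ Ψ = Ψ^bs ∘ Base` on the nose; `ψConj` — the birational transport `u ↦ conjFn u` on `O^×(A^birat)`.
Sequel (proof-only): Thm 4.4 (i)–(iv) FIRE for `(Ψ, Ψ^bs)`; `transportBaseAut` is NEGATION on `Aut(X_N) = ℤ/N`.
HONEST LIMITS: a toy (𝔾_m; trivial [FrdI] vocabularies; `(N,H)`-slot `True`); `c ↦ c⁻¹` is the algebraic stand-in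
for `c ↦ c̄` (both invert roots of unity, which is all the tower sees); consistency ≠ faithfulness; typed ≠ proved.
DATA file (`def`s are objects; no `Prop`-valued definition, no named fact, no instance).  Nothing here bears on, or
takes a side on, [IUTchIII] Cor. 3.12.
-/

noncomputable section

namespace Literature.AnabelianGeometry.EtaleTheta

open CategoryTheory Opposite Literature.AlgebraicGeometry.Frobenioids
open scoped NNRat

namespace ToyTower

open Base

/-! ## The base involution: negate the deck transformations -/

/-- **`Ψ^bs`: negate every shift** (`t ↦ t̄` sends `ζ_N^a` to `ζ_N^{-a}`); identity on objects.
[cite: MochizukiEtTh2009, Thm 4.4 p.93] -/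
def negBase : ToyTower.Base ⥤ ToyTower.Base where
  obj A := A
  map f := ⟨-f.shift, f.dvd⟩
  map_id A := hom_ext (by
    change -(𝟙 A : A ⟶ A).shift = (𝟙 A : A ⟶ A).shift
    rw [id_shift, neg_zero])
  map_comp f g := hom_ext (by
    change -(f ≫ g).shift = ZMod.castHom g.dvd _ (-f.shift) + -g.shift
    rw [comp_shift, map_neg, neg_add])

/-- Shift of `negBase f`. [cite: MochizukiEtTh2009, Thm 4.4 p.93] -/
@[simp] theorem negBase_map_shift {A B : ToyTower.Base} (f : A ⟶ B) : (negBase.map f).shift = -f.shift := rfl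

/-- `negBase` is an involution on morphisms. [cite: MochizukiEtTh2009, Thm 4.4 p.93] -/
theorem negBase_negBase_map {A B : ToyTower.Base} (f : A ⟶ B) : negBase.map (negBase.map f) = f :=
  hom_ext (neg_neg f.shift)

/-- **`Ψ^bs` as a self-equivalence of the tower** (its own inverse). [cite: MochizukiEtTh2009, Thm 4.4 p.93] -/
def negBaseEquiv : ToyTower.Base ≌ ToyTower.Base :=
  CategoryTheory.Equivalence.mk negBase negBase
    (NatIso.ofComponents (fun X => Iso.refl X) (fun {X Y} f => by
      erw [Category.comp_id, Category.id_comp]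
      exact (negBase_negBase_map f).symm))
    (NatIso.ofComponents (fun X => Iso.refl X) (fun {X Y} f => by
      erw [Category.comp_id, Category.id_comp]
      exact negBase_negBase_map f))

/-! ## The unit twist: invert constants -/

/-- The twist picked up along `negBase f` is the inverse of the twist along `f` (`ζ^{(-a) n} = (ζ^{a n})⁻¹`).
[cite: MochizukiEtTh2009, Def 3.3 p.73] -/
theorem twist_negBase {A B : ToyTower.Base} (f : A ⟶ B) (n : Multiplicative ℤ) :
    ToyTower.twist (negBase.map f) n = (ToyTower.twist f n)⁻¹ := by
  haveI : NeZero ((B.lvl : ℕ)) := ⟨B.lvl.ne_zero⟩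
  change Circle.toUnits (ZMod.toCircle (((Multiplicative.toAdd n : ℤ) : ZMod B.lvl) * -f.shift)) =
    (Circle.toUnits (ZMod.toCircle (((Multiplicative.toAdd n : ℤ) : ZMod B.lvl) * f.shift)))⁻¹
  rw [mul_neg, AddChar.map_neg_eq_inv, map_inv]

/-- **`conjFn`: invert the constant** of a monomial function, `c·t^n ↦ c⁻¹·t^n` (divisor unchanged), on the
rational-function monoid `B(X_N)` of the tower Frobenioid. [cite: MochizukiEtTh2009, Def 3.6 p.77] -/
def conjFn (A : ToyTower.Baseᵒᵖ) :
    ToyTower.temperedFrobenioid.ratFnFunctor.obj A →* ToyTower.temperedFrobenioid.ratFnFunctor.obj A where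
  toFun x := ⟨((x.1.1.1⁻¹, x.1.1.2), x.1.2), x.2⟩
  map_one' := Subtype.ext (Prod.ext (Prod.ext inv_one rfl) rfl)
  map_mul' _ _ := Subtype.ext (Prod.ext (Prod.ext (mul_inv _ _) rfl) rfl)

/-- `conjFn` is an involution. [cite: MochizukiEtTh2009, Def 3.6 p.77] -/
theorem conjFn_conjFn (A : ToyTower.Baseᵒᵖ) (x : ToyTower.temperedFrobenioid.ratFnFunctor.obj A) :
    conjFn A (conjFn A x) = x :=
  Subtype.ext (Prod.ext (Prod.ext (inv_inv _) rfl) rfl)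

/-- `conjFn` as a multiplicative equivalence of `B(X_N)`. [cite: MochizukiEtTh2009, Def 3.6 p.77] -/
def conjFnEquiv (A : ToyTower.Baseᵒᵖ) :
    ToyTower.temperedFrobenioid.ratFnFunctor.obj A ≃* ToyTower.temperedFrobenioid.ratFnFunctor.obj A :=
  { conjFn A with
    invFun := conjFn A
    left_inv := conjFn_conjFn A
    right_inv := conjFn_conjFn A }

/-- **`conjFn` intertwines pull-back along `f` with pull-back along `negBase f`**:
`(c ζ_N^{an} · t_M^{kn})⁻¹`-constant `= c⁻¹ ζ_N^{-an}`. [cite: MochizukiEtTh2009, Def 3.6 p.77] -/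
theorem conjFn_map {A A' : ToyTower.Baseᵒᵖ} (f : A ⟶ A') (x : ToyTower.temperedFrobenioid.ratFnFunctor.obj A) :
    conjFn A' ((ToyTower.temperedFrobenioid.ratFnFunctor.map f).hom x) =
      (ToyTower.temperedFrobenioid.ratFnFunctor.map (negBase.map f.unop).op).hom (conjFn A x) := by
  apply Subtype.ext
  change (((((ToyTower.temperedFrobenioid.ratFnPull f x).1.1.1)⁻¹, (ToyTower.temperedFrobenioid.ratFnPull f x).1.1.2),
      (ToyTower.temperedFrobenioid.ratFnPull f x).1.2) : (ToyTower.Fn × _)) =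
    (ToyTower.temperedFrobenioid.ratFnPull (negBase.map f.unop).op (conjFn A x)).1
  rw [TemperedFrobenioid.coe_ratFnPull, TemperedFrobenioid.coe_ratFnPull]
  refine Prod.ext ?_ rfl
  change (((ToyTower.pullFn f.unop x.1.1).1)⁻¹, (ToyTower.pullFn f.unop x.1.1).2) =
    ToyTower.pullFn (negBase.map f.unop) ((x.1.1.1⁻¹, x.1.1.2) : ToyTower.Fn)
  rw [pullFn_apply, pullFn_apply, twist_negBase, mul_inv]
  rfl

/-! ## The self-functor `Ψ` of the tower Frobenioid over `Ψ^bs = negBase` -/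

/-- **The conjugation-type self-functor `Ψ`** of the tower Frobenioid: identity on objects; on a morphism
`(deg_Fr, Base(φ), Div(φ), u_φ)` of the model Frobenioid ([FrdI] Thm 5.2 (i)) it NEGATES the base arrow's shift and
INVERTS the constant of `u_φ` (the relation (d) only sees `Div_B(u_φ)` and the degree of `Base(φ)`).
[cite: MochizukiEtTh2009, Thm 4.4 p.93] -/
def conj : ToyTower.temperedFrobenioid.category ⥤ ToyTower.temperedFrobenioid.category where
  obj X := X
  map {X Y} φ := ModelFrobenioid.mkHom X Y (ModelFrobenioid.degFr φ) (negBase.map (ModelFrobenioid.baseMap φ))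
    (ModelFrobenioid.div φ) (conjFn _ (ModelFrobenioid.unit φ)) φ.rel
  map_id X := ModelFrobenioid.hom_ext rfl (negBase.map_id _) rfl (map_one (conjFn _))
  map_comp φ ψ := ModelFrobenioid.hom_ext rfl (negBase.map_comp _ _) rfl (by
    change conjFn _ ((ToyTower.temperedFrobenioid.ratFnFunctor.map (ModelFrobenioid.baseMap φ).op).hom
        (ModelFrobenioid.unit ψ) * ModelFrobenioid.unit φ ^ (ModelFrobenioid.degFr ψ : ℕ)) = _
    rw [map_mul, map_pow, conjFn_map]
    rfl)

/-- `Ψ ∘ Ψ = 𝟭` on morphisms. [cite: MochizukiEtTh2009, Thm 4.4 p.93] -/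
theorem conj_map_conj_map {X Y : ToyTower.temperedFrobenioid.category} (φ : X ⟶ Y) :
    conj.map (conj.map φ) = φ :=
  ModelFrobenioid.hom_ext rfl (negBase_negBase_map _) rfl (conjFn_conjFn _ _)

/-- **`Ψ` as a self-equivalence** (its own inverse). [cite: MochizukiEtTh2009, Thm 4.4 p.93] -/
def conjEquiv : ToyTower.temperedFrobenioid.category ≌ ToyTower.temperedFrobenioid.category :=
  CategoryTheory.Equivalence.mk conj conj
    (NatIso.ofComponents (fun X => Iso.refl X) (fun {X Y} φ => by
      erw [Category.comp_id, Category.id_comp]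
      exact (conj_map_conj_map φ).symm))
    (NatIso.ofComponents (fun X => Iso.refl X) (fun {X Y} φ => by
      erw [Category.comp_id, Category.id_comp]
      exact conj_map_conj_map φ))

/-! ## The `Thm44Hyp` inhabitant with `Ψ^bs = negBase` -/

variable (p : ℕ) [Fact p.Prime]

/-- **`(Ψ, Ψ^bs) = (conjEquiv, negBaseEquiv)` inhabits `Thm44Hyp`** between the tower setting and itself:
`Base ∘ Ψ = Ψ^bs ∘ Base` ON THE NOSE (components `Iso.refl`), `D = D₀[X_1]`, `H_⊙ = Π^tp_X` open (part 12).
[cite: MochizukiEtTh2009, Thm 4.4 p.93] -/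
def thm44HypConj : BiKummerSetting.Thm44Hyp (ToyTower.biKummerSetting p) (ToyTower.biKummerSetting p) where
  isNonDilating₁ _ _ := trivial
  isNonDilating₂ _ _ := trivial
  baseShape₁ := ⟨(inferInstance : (𝟭 ToyTower.Base).Full), (inferInstance : (𝟭 ToyTower.Base).Faithful), ⟨1⟩,
    fun Y => ⟨fun _ => ⟨toOne Y⟩, fun _ => ⟨Y, ⟨Iso.refl _⟩⟩⟩⟩
  baseShape₂ := ⟨(inferInstance : (𝟭 ToyTower.Base).Full), (inferInstance : (𝟭 ToyTower.Base).Faithful), ⟨1⟩,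
    fun Y => ⟨fun _ => ⟨toOne Y⟩, fun _ => ⟨Y, ⟨Iso.refl _⟩⟩⟩⟩
  isOpen_Hodot₁ := by rw [hodot_eq_top, Subgroup.coe_top]; exact isOpen_univ
  isOpen_Hodot₂ := by rw [hodot_eq_top, Subgroup.coe_top]; exact isOpen_univ
  Ψ := conjEquiv
  Ψbs := negBaseEquiv
  comm := NatIso.ofComponents (fun _ => Iso.refl _) (fun _ => (Category.comp_id _).trans (Category.id_comp _).symm)
  mapsAodot := ⟨Iso.refl _⟩

/-- The birational transport `ψ_A := conjFn` on `O^×(A^birat) = B(A^bs)^×` accompanying `Ψ`.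
[cite: MochizukiEtTh2009, Thm 4.4 p.94] -/
def ψConj (A : (ToyTower.biKummerSetting p).C) :
    (ToyTower.biKummerSetting p).biratUnits A ≃* (ToyTower.biKummerSetting p).biratUnits ((thm44HypConj p).Ψ.functor.obj A) :=
  Units.mapEquiv (conjFnEquiv (op A.base))

end ToyTower

end Literature.AnabelianGeometry.EtaleTheta

end
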